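import Mathlib
import HarnessLib
import HarnessLib.Audit
import Summits.AtomisticToContinuum.Statement
import Literature.MathematicalPhysics.QuantumManyBody.PeriodicBoseGas
import HarnessLib.Audit.Status.Attr

/-!
Route: BlockLatticeFSum

# Route BlockLatticeFSum — lattice f-sum identity on the block torus — super-block condensation
(13595 twice) empties every infrared shell but the deepest

decomp-a2c NODE (lens «barrier-complement carving», gen 22): an ALTERNATIVE DECOMPOSITION of the
target of
route-AtomisticToContinuum-BECIntegerBlockRotor around its blocker BlockInfraredBound
(stmt-AtomisticToContinuum-13593), sharing the
parent's decls (a separate route, not a D-0170 refinement: 13593 is by-passed, not concluded). It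
suffices to show X =
BlockCondensation ∧ DeepInfraredEmptiness ∧ BoundaryTransferWeak: (1) the parent's box-uniform
single-block condensation (stmt-13595,
shared verbatim, ATTACKABLE with a registered skeleton) — used TWICE, for the blocks of GP side l =
L/K ∈ [A,2A]ρ^(-1/2) (4 ∣ K) and for
the 2×2×2 super-blocks (block constant 2A, K/2 per side); (2) the block plane waves f_q with 0 <
ε(q) < θ carry at most N/8 particles for
SOME block scale A and shell depth θ (DeepInfraredEmptiness, the declared residual and the only new
crux); (3) the parent's periodic →
Dirichlet transfer (stmt-0827, shared verbatim). The exact lattice f-sum identity Σ_q ε(q) n(f_q) =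
Σ_(j,B) n(a_(B,j)) (a = antisymmetric
bond mode of neighbouring blocks; kernel-proved in abstract form), Cauchy–Schwarz inside each
super-block and the 8 half-shifted super-block
tilings turn (1) into Σ_q ε(q) n(f_q) ≤ 6ηN (support ShellBudget); Chebyshev in ε empties the shells
ε ≥ θ, (2) the rest, and Parseval on
the block span (support ShellModeCounting) gives n(f_0) = condensate ≥ 5N/8 on the torus; (3) moves
it to the Dirichlet box.
Lean: `BlockCondensation ∧ DeepInfraredEmptiness ∧ BoundaryTransferWeak`

## Assembly
Pure modus ponens (glue.lean, kernel-checked): fun v hv => hBT v hv (hMC (hSB hBC) hDI hBC v hv) —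
ShellBudget turns BlockCondensation into
the ε-weighted budget, ShellModeCounting consumes the budget, DeepInfraredEmptiness and
BlockCondensation and yields periodic BEC for v;
BoundaryTransferWeak v turns it into ∃ ρ₀ ∀ ρ < ρ₀ HasGroundStateBEC v ρ, i.e. the conjunct. Every
binder is consumed (BC6: declared 6 /
in-cone 5 / Assembly exempt); the Assembly item below records the same implication (schema: exactly
one assembly item).

Rationale: WHY THIS LINE. The parent reaches the conjunct through BlockInfraredBound (13593), a POINTWISE bound
n(f_q) ≤ C/√ε(q) whose only engine is Gaussian
domination / reflection positivity for a blocked continuum gas (13592, exact-or-nothing; barriers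
HalfFillingReflectionPositivity,
GaussianDomination) plus integer filling K³ ∣ N and a FillingContinuity crux (13594). This line
observes that the block indicators u_B and
the block plane waves f_q are two orthonormal bases of the same K³-dimensional span, so the
ε-weighted occupation is an exact
position-space quantity: the total occupation of the nearest-neighbour antisymmetric bond modes
a_(B,j) = (u_B − u_(B+e_j))/√2; inside a
2×2×2 super-block S the four j-bonds carry at most N_S − n(u_S) (Cauchy–Schwarz for the positive
form n, n(u_B) ≤ N_B), i.e. the condensate
DEFICIT of the cube S of side 2l; every bond is interior to 4 of the 8 half-shifted super-block
tilings, and super-block condensation of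
each tiling is the parent's 13595 at block constant 2A applied to a translate of the near-minimiser
(the torus is translation invariant).
Hence 13595 alone — GP-scale local condensation in cubes, LSSY2005 Thm 5.1 / Lemma 5.2,
Fournais2020: theorems — bounds Σ_q ε(q) n(f_q) by
6ηN with η → 0 at fixed A. Imported area: finite Fourier analysis on (ℤ/K)³ (Plancherel for the
discrete gradient,
Mathlib AddChar.sum_mulShift) and the mode-counting half of KLS1988JSP §2; NOT imported: reflection
positivity, sector gaps, Bogoliubov
theory. What it does that prior routes do not: the provable part reaches every shell ε(q) ≥ θ with θ
FREE (momenta down to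
√θ·√ρ/A = o(inverse healing length)), whereas BECPhononFloor.MesoscopicTail stops at a fixed
multiple of the inverse healing length,
BECInfDivCoherence / BECLevyCoherence pay the discrete f-sum with kinetic energy (O(A²a)·N at block
scale, not o(N)), and the dyadic
ladders (BECDyadicChaining, CoherentDoubling, ScaleConvexity) need coherence gains at EVERY scale up
to L; negatives steered around:
stmt-14490 BerryStiffPhaseLRO, stmt-3980 SwapJensen (neither restated).

RANKED CRUXES. #2 DeepInfraredEmptiness (crux) — DECLARED RESIDUAL. For every repulsive finite-range
v there are a block scale A > 0 and a shell depth θ > 0 such that at every small density ρ,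
eventually in N (torus of side (N/ρ)^(1/3)), some δ > 0, every periodic δ-near-minimiser and every
even K > 0 with L/K ∈ [A,2A]ρ^(-1/2): the block plane waves f_q, q ∈ {0..K−1}³ with q ≠ 0 and ε(q) =
Σ_j (1 − cos(2πq_j/K)) < θ, carry total occupation ≤ N/8. Implied for every θ by the pointwise bound
n(f_q) ≤ C/√ε(q) (Σ_(ε<θ) C/√ε(q) ≤ C'CθK³ = o(N)) — i.e. by 13593 literally along K³ ∣ N and by its
filling-free form for all even K — and by complete BEC; separated from BEC by the block-Fock product
state; quantified ∃A ∃θ (both free). [difficulty: open-problem] (why it might fail: only if dilute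
torus near-ground states put a fixed fraction of the gas into the O(θ^(3/2)K³) deepest block waves
for EVERY θ and A — generalised (type II/III) condensation of the interacting gas; no box-uniform
tool controls |k| ≲ inverse healing length (Bogoliubov is a theorem only to GP⁺ scales).)
[KLS1988PRL, LSSY2005, Fournais2020, PuleZagrebnov2004,
Literature.Barriers.AtomisticToContinuum.CasimirBoxGeneralizedCondensation,
Literature.Barriers.AtomisticToContinuum.BogoliubovPerturbationInfrared,
stmt-AtomisticToContinuum-13593]
#3 BlockCondensation (crux) — the parent's item stmt-AtomisticToContinuum-13595 VERBATIM (shared;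
re-asking attaches this route): box-uniform single-block condensation Σ_B ⟨u_B, γ_Ψ u_B⟩ ≥ (1 − η)N
for near-minimisers, for every A, η, every even K in the A-window. Used twice by this route: blocks
(A, η = 1/8) in ShellModeCounting and super-blocks (2A, η = θ/48, K/2 per side) in ShellBudget.
[difficulty: L] (why it might fail: per-box application of LSSY Thm 2.4 requires a local
particle-number window; under/over-filled blocks must be handled by capping and monotonicity; K = 2
boxes; the δ-uniformity over K.) [LSSY2005, Fournais2020, stmt-AtomisticToContinuum-13595]
#4 BoundaryTransferWeak (crux) — the parent's item stmt-AtomisticToContinuum-0827 VERBATIM (shared;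
the cell's second blocker, untouched by this node): periodic ground-state BEC at all small densities
implies Dirichlet ground-state BEC (HasGroundStateBEC) at all small densities, for every repulsive
finite-range v. [difficulty: open-problem] (why it might fail: periodic → Dirichlet costs a boundary
layer of energy ~ ρ^(2/3)N^(1/3)·L² ≫ gap; the transfer of λ_max between boundary conditions at
fixed density is not a theorem (LSSY treat Dirichlet only via the GP route of Ch. 7).) [LSSY2005,
stmt-AtomisticToContinuum-0827, stmt-AtomisticToContinuum-0826]
#9 ShellBudget (support) — PROVABLE NOW (kinematics; the identity is kernel-proved in abstract form
in HOME g22/BlockLatticeFSumEngine.lean: fsum_axis, fsum_total). BlockCondensation (13595) → for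
every (v, A, η): ρ₀, N₀ and per box δ (those of 13595 at block constant 2A) such that every
δ-near-minimiser and every K with 4 ∣ K in the A-window satisfy Σ_q ε(q)·⟨f_q, γ_Ψ f_q⟩ ≤ 6ηN, q
over {0..K−1}³, f_q the block plane waves of 13593. Proof: (1) Σ_q ε(q) n(f_q) = Σ_(j,B) n(a_(B,j))
(finite Plancherel on (ℤ/K)³); (2) per super-block S and axis: Σ_(4 bonds) n(a) ≤ Σ_(B⊂S) n(u_B) −
n(u_S) ≤ N_S − n(u_S) (n(a)+n(d) = n(u_B)+n(u_B'), u_S = ½Σ_pairs d so n(u_S) ≤ Σ_pairs n(d) by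
Cauchy–Schwarz, n(u_B) ≤ N_B); (3) each bond interior to 4 of the 8 half-shifted tilings T_s, and
Σ_(S∈T_s) n(u_S) ≥ (1−η)N is 13595 (2A, K/2 even) applied to the translate Ψ(· + s·l) (periodic
energy, near-minimality and cellOccupation are translation covariant): total ≤ ¼·8·3·ηN.
[difficulty: provable-now] [KLS1988JSP, LSSY2005, stmt-AtomisticToContinuum-13597]
#9 ShellModeCounting (support) — PROVABLE NOW (Parseval on the block span, as the parent's 13597
(i)): ShellBudgetC → DeepInfraredEmptiness → BlockCondensation → periodic BEC for every admissible v
(the antecedent of 0827 with c = 5/8). Proof: fix v; the residual gives A, θ, ρ₀; run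
BlockCondensation with (A, 1/8) and the budget with (A, θ/48); for ρ below all thresholds and N
large (L = (N/ρ)^(1/3), N = ρL³, a K with 4 ∣ K in the window exists, δ = min): Σ_q n(f_q) = Σ_B
n(u_B) ≥ 7N/8, Σ_(q≠0, ε≥θ) n(f_q) ≤ θ⁻¹·6(θ/48)N = N/8 (shell_chebyshev), Σ_(q≠0, ε<θ) ≤ N/8, hence
n(f_0) ≥ 5N/8 and f_0·1_cell = constantMode L. [difficulty: provable-now] [KLS1988JSP, LSSY2005,
stmt-AtomisticToContinuum-13597]

TWO-LAYER PLAN. BlockCondensation (13595) already has its registered birth skeleton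
(Cruxes/BlockCondensation/Lines/birth.lean: stub_blockBracketing →
stub_boxPinnedGapBound → stub_blockEnergyAccounting → BlockCondensation_of). ShellBudget ⇐
(translation covariance of periodic
near-minimisers and of cellOccupation) → (cellOccupation N L · Ψ is a positive Hermitian form on the
block span: Gram representation
n(g) = ‖T_Ψ g‖²) → ShellBudget via the abstract engine (fsum_total + Cauchy–Schwarz + tiling count).
DeepInfraredEmptiness ⇐ (13593
restricted to ε(q) < θ, i.e. the parent's RP line on the deep shell only) or (a Landau/sector-gap
floor transported to block waves:
BECNoCheapMomentum.SectorGapFloor + a leakage lemma) — recorded, NOT filed (both are existing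
routes' cruxes).

KILL CRITERIA. A near-ground state family (or a rigorous trial-state computation at Bogoliubov
precision) with Σ_(0<ε(q)<θ) n(f_q) ≥ N/8 for every θ at
arbitrarily small ρ refutes DeepInfraredEmptiness and closes the route
(refuted:DeepInfraredEmptiness) — it would also refute 13593 and
every block-rotor route. BlockCondensation (13595) refuted through the δ-uniformity over the
K-window ⇒ pivot with the parent: restate with δ
after K (∀ K ∃ δ), which ShellBudget/ShellModeCounting tolerate (they use one K and its half).
BlockInfraredBound 13593 proved elsewhere moots the residual (13593 ⇒
DeepInfraredEmptiness); PeriodicBEC (stmt-0826) proved elsewhere moots everything but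
BoundaryTransferWeak (superseded).

NOT DECOMPOSED YET. The plumbing lemmas "cellOccupation is a Hermitian quadratic form in the mode"
and "Parseval over an orthonormal family of cell modes"
(shared debt with the parent's 13597), the translation-covariance lemma for PeriodicTrialState, and
any attack on the residual are layer-2; constants (1/8, 5/8, 6, θ/48, the window factor 2) are fixed
by the mode count and not tuned.

CHEAPEST FALSIFIER. Bogoliubov trial-state arithmetic for the residual: n(f_q) ≈ (l/ξ)/(4√ε(q)) per
block wave (ξ = healing length, l = block side), so
Σ_(0<ε<θ) n(f_q) ≈ (l/ξ)·θ·K³ = (l/ξ)θ·N/(ρl³) → 0 at fixed A, θ as ρ → 0 (ρl³ = A³ρ^(-1/2) → ∞):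
consistent, no kill. The in-Lean
cheapest check ran: #h21_crux_probe on the new decls (ShellBudget, DeepInfraredEmptiness,
ShellModeCounting) — see DONE bc7 (C → S fails, no vacuity, no rigidity). A kit census of
Σ_(ε<θ) n(f_q)/N by diffusion Monte Carlo at ρa³ = 1e-4…1e-2 would be the instrument (kit not
allowed on this seat).

NUMBERS. Window l = L/K ∈ [A, 2A]ρ^(-1/2) (GP scale: ρa·l² = A²·ρ^0·a… fixed GP parameter n a/l =
A³a√ρ·… → per-box LSSY Thm 5.1 regime);
LSSY Thm 5.1 depletion rate ≤ C·Y^(1/17) at fixed g = Na/L ([LSSY2005] (5.15)–(5.17)); lattice count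
#{q ∈ (ℤ/K)³ : ε(q) < θ} ≍ K³θ^(3/2)
for θ ≤ 1; identity constants: Σ_q ε(q) n(f_q) = Σ_(j,B) n(a_(B,j)), Σ_q ε(q) n(f_q) + Σ_(j,B)
n(d_(B,j)) = 6 Σ_B n(u_B) (fsum_total); each bond interior to 4 of 8
half-shifted super-block tilings; 3 axes; budget ¼·8·3·η = 6η; mode count 1 − 1/8 − 1/8 − 1/8 = 5/8.

DEFINITION REQUESTS. None: all modes are inlined over cellOccupation / PeriodicTrialState /
sideLength (Literature.MathematicalPhysics.QuantumManyBody.PeriodicBoseGas,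
BoseEinsteinCondensation); the abstract engine lives in HOME g22/BlockLatticeFSumEngine.lean
(Mathlib only) and is offered for landing under
Theorems/ by a prover seat (supports ShellBudget).

Novelty: Searches (2026-08-31): tree — rg "1 - Real.cos (2 \* Real.pi" over the 143 BoseEinsteinCondensation
Theses (hits: BECIntegerBlockRotor, BECBlockRotorRP only, both RP-paid); rg -i "dimer|double
block|adjacent blocks|f-sum|discrete Laplacian|coarse-grain" (hits: BECInfDivCoherence,
BECLevyCoherence — fine-lattice discrete f-sum ≤ 2τ paid by kinetic energy;
BECPhononFloor.MesoscopicTail; BECDyadicChaining/BECScaleChaining/BECCoherentDoubling;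
BECInfraredBound); cell census COSTUME-CENSUS-v10 (all BEC* rows); ledger negatives (2 BEC rows:
stmt-14490, stmt-3980). lit search --hybrid "generalized condensation interacting Bose gas infrared
momentum modes coarse-grained density matrix" (8 book hits;
[corpus:book:lieb2005-mathematics-bose-gas-its-condensation p.36 Thm 5.1, pp.38–39 rate Y^(1/17)]);
lit galaxy search "generalized condensation|generalised condensation" --star all (11 rows;
[galaxy:pdf:1144195480] Jaeck–Pulé–Zagrebnov, generalized BEC in disordered systems); no hit states
the block-torus f-sum identity for a continuum gas (no hits for "block plane wave" / "double block
condensation" in corpus(fts+vec) and galaxy).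
Nearest prior art found: route-AtomisticToContinuum-BECIntegerBlockRotor (same block basis; pays
ε(q) with RP/Gaussian domination 13592 and needs K³ ∣ N); route BECPhononFloor (MesoscopicTail:
coarse-graining tail above a FIXED multiple of the inverse healing length + LinearPhononFloor);
KLS1988JSP §2 (mode counting from an infrared bound on a lattice); LSSY200  [refs: book:lieb2005-mathematics-bose-gas-its-condensation, LSSY2005]

Barriers (technique_class: barrier-complement-carving, local-condensation): - technique_class: barrier-complement-carving, local-condensation
- Literature.Barriers.AtomisticToContinuum.HalfFillingReflectionPositivity: evaded by construction —
no reflection positivity, no Gaussian domination, no half filling, no integer filling; 13592/13593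
are not in the cone (ShellBudget, ShellModeCounting use only 13595, tilings, Cauchy–Schwarz and
Plancherel); the ε(q) weight enters through an identity valid for every state.
- Literature.Barriers.AtomisticToContinuum.HalfFillingReflectionPositivityNarrow: same — no
reflection of the STATE through bond-bisecting planes is used; the super-block tilings are
translates, not reflections.
- Literature.Barriers.AtomisticToContinuum.BogoliubovPerturbationInfrared: ShellBudget's only
energetic input is 13595 at GP-box scale (2l ≤ 4Aρ^(-1/2)), where LSSY Thm 5.1 is a theorem; it DOES
bite the residual DeepInfraredEmptiness (momenta below √θ·√ρ/A) — recorded as that leaf's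
BARRIER-adjacent tag; the bet is that an occupation BUDGET of N/8 on o(K³) modes is weaker than any
expansion-grade statement.
- Literature.Barriers.AtomisticToContinuum.CasimirBoxGeneralizedCondensation: its hypotheses (free
gas, anisotropic Casimir boxes) are violated by construction (cubic torus, v repulsive); it is
exactly the phenomenon the residual excludes and is cited as the reason the residual is UNDECIDED,
not as an applicable no-go.
- Literature.Barriers.AtomisticToContinuum.KineticGapLengthScales: no spectral gap of the big torus
is used; the o

History (route lifecycle, newest last):
- 2026-08-31T02:17:09Z · RESIDUAL declared: DeepInfraredEmptiness (stmt-AtomisticToContinuum-27506) — summit-strength until shown otherwise: decomp-a2c g22 node: the only new crux; UNDECIDED (∃A ∃θ occupation budget N/8 on the deepest block-wave shell; implied (planner-decomp-a2c-lens-6-g22-0)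

sub-problem: BoseEinsteinCondensation · status: draft · opened planner-decomp-a2c-lens-6-g22-0 2026-08-31T02:15:53Z · rev 0 · ledger route-AtomisticToContinuum-BlockLatticeFSum
GENERATED by the gate from the ledger (D-0016/17). Provers cite these decls: `theorem foo : Summit.AtomisticToContinuum.BoseEinsteinCondensation.Theses.BlockLatticeFSum.<Decl> := …` in Summits/AtomisticToContinuum/BoseEinsteinCondensation/Theorems/<Name>.lean.
-/

namespace Summit.AtomisticToContinuum.BoseEinsteinCondensation.Theses.BlockLatticeFSum

open scoped BigOperators Topology Manifold Classical MeasureTheory ProbabilityTheory Matrix InnerProductSpace ComplexConjugate ContinuousMap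
open Filter Set Function TopologicalSpace MeasureTheory

attribute [summit_statement] _root_.BoseEinsteinCondensation

/-- item stmt-AtomisticToContinuum-27506 · crux · RESIDUAL (gen 0; summit-strength until shown otherwise, D-0170) · rank 2 · open · by planner
why it might fail: only if dilute torus near-ground states put a fixed fraction of the gas into the O(θ^(3/2)K³) deepest block waves for EVERY θ and A — generalised (type II/III) condensation of the interacting gas; no box-uniform tool controls |k| ≲ inverse healing length (Bogoliubov is a theorem only to GP⁺ scales).
sources: KLS1988PRL, LSSY2005, Fournais2020, PuleZagrebnov2004, Literature.Barriers.AtomisticToContinuum.CasimirBoxGeneralizedCondensation, Literature.Barriers.AtomisticToContinuum.BogoliubovPerturbationInfrared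
[crux] DECLARED RESIDUAL. For every repulsive finite-range v there are a block scale A > 0 and a
shell depth θ > 0 such that at every small density ρ, eventually in N (torus of side (N/ρ)^(1/3)),
some δ > 0, every periodic δ-near-minimiser and every even K > 0 with L/K ∈ [A,2A]ρ^(-1/2): the
block plane waves f_q, q ∈ {0..K−1}³ with q ≠ 0 and ε(q) = Σ_j (1 − cos(2πq_j/K)) < θ, carry total
occupation ≤ N/8. Implied for every θ by the pointwise bound n(f_q) ≤ C/√ε(q) (Σ_(ε<θ) C/√ε(q) ≤
C'CθK³ = o(N)) — i.e. by 13593 literally along K³ ∣ N and by its filling-free form for all even K —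
and by complete BEC; separated from BEC by the block-Fock product state; quantified ∃A ∃θ (both
free). [difficulty: open-problem] -/
@[route_item "route-AtomisticToContinuum-BlockLatticeFSum", crux (bottleneck := idea) (source := "ledger wanted_by.residual on stmt-AtomisticToContinuum-27506, 2026-09-01")]
def DeepInfraredEmptiness : Prop :=
  ∀ v : ℝ → ENNReal, Literature.MathematicalPhysics.QuantumManyBody.BoseGas.IsRepulsiveFiniteRange v → ∃ A : ℝ, 0 < A ∧ ∃ θ : ℝ, 0 < θ ∧ ∃ ρ₀ : ℝ, 0 < ρ₀ ∧ ∀ ρ : ℝ, 0 < ρ → ρ < ρ₀ → ∀ᶠ N : ℕ in Filter.atTop, ∃ δ : ENNReal, 0 < δ ∧ ∀ Ψ : Literature.MathematicalPhysics.QuantumManyBody.BoseGas.PeriodicTrialState N (Literature.MathematicalPhysics.QuantumManyBody.BoseGas.sideLength ρ N), Literature.MathematicalPhysics.QuantumManyBody.BoseGas.periodicEnergy v Ψ ≤ Literature.MathematicalPhysics.QuantumManyBody.BoseGas.periodicGroundStateEnergy v N (Literature.MathematicalPhysics.QuantumManyBody.BoseGas.sideLength ρ N) + δ → ∀ K : ℕ,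 Even K → 0 < K → A / Real.sqrt ρ ≤ Literature.MathematicalPhysics.QuantumManyBody.BoseGas.sideLength ρ N / (K : ℝ) ∧ Literature.MathematicalPhysics.QuantumManyBody.BoseGas.sideLength ρ N / (K : ℝ) ≤ 2 * A / Real.sqrt ρ → (∑ q ∈ (Finset.univ.filter fun q : Fin 3 → Fin K => ¬ (∀ j : Fin 3, (q j : ℕ) = 0) ∧ (∑ j : Fin 3, (1 - Real.cos (2 * Real.pi * ((q j : ℕ) : ℝ) / (K : ℝ)))) < θ), Literature.MathematicalPhysics.QuantumManyBody.BoseGas.cellOccupation N (Literature.MathematicalPhysics.QuantumManyBody.BoseGas.sideLength ρ N) (fun x : EuclideanSpace ℝ (Fin 3) => (((Real.sqrt (Literature.MathematicalPhysics.QuantumManyBody.BoseGas.sideLength ρ N ^ 3))⁻¹ : ℝ) : ℂ) * Complex.exp (((2 * Real.pi * (∑ j : Fin 3, ((q j : ℕ) : ℝ) * (⌊(K : ℝ) * x j / Literature.MathematicalPhysics.QuantumManyBody.BoseGas.sideLength ρ N⌋ : ℝ)) / (K : ℝ) : ℝ) : ℂ) * Complex.I)) Ψ.ψ) ≤ ENNReal.ofReal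 ((N : ℝ) / 8)

/-- item stmt-AtomisticToContinuum-13595 · crux · rank 3 · closed · proved by Summit.AtomisticToContinuum.BoseEinsteinCondensation.Theorems.BlockCondensation.blockCondensation_proof (prover) · by planner
why it might fail: per-box application of LSSY Thm 2.4 requires a local particle-number window; under/over-filled blocks must be handled by capping and monotonicity; K = 2 boxes; the δ-uniformity over K.
sources: LSSY2005, Fournais2020, stmt-AtomisticToContinuum-13595
[crux] INTRA-BLOCK BEC SUMMED OVER BLOCKS (the ultraviolet half; sum-rule side of KLS), box-uniform
and with NO integer-filling hypothesis: for every A > 0 and η > 0 there are ρ₀, N₀ such that for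
every box (N ≥ N₀, N ≤ ρ₀L³), some δ > 0, every periodic δ-near-minimiser Ψ and every even K > 0
with A/√(N/L³) ≤ L/K ≤ 2A/√(N/L³): Σ_B ⟨u_B, γ_Ψ u_B⟩ ≥ (1 − η)N for the normalised block indicators
u_B = (L/K)^(-3/2) 1_(⌊Kx/L⌋ = B). Route to proof, inputs PROVED in tree: Neumann bracketing of the
torus into K³ blocks (v ≥ 0 drops cross pairs), per-block LSSY Thm 2.4 lower bound with capping for
under/over-filled blocks, global Thm 2.2 upper bound, Jensen on Σ n_B², and the gap step of LSSY
Lemma 5.2 inside each block: depletion ≤ C A² a (Y^(1/17) + a/b) N → 0 at fixed A. [difficulty: L] -/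
@[route_item "route-AtomisticToContinuum-BlockLatticeFSum", crux]
def BlockCondensation : Prop :=
  ∀ v : ℝ → ENNReal, Literature.MathematicalPhysics.QuantumManyBody.BoseGas.IsRepulsiveFiniteRange v → ∀ A : ℝ, 0 < A → ∀ η : ℝ, 0 < η → ∃ ρ₀ : ℝ, 0 < ρ₀ ∧ ∃ N₀ : ℕ, ∀ (N : ℕ) (L : ℝ), 0 < L → N₀ ≤ N → (N : ℝ) ≤ ρ₀ * L ^ 3 → ∃ δ : ENNReal, 0 < δ ∧ ∀ Ψ : Literature.MathematicalPhysics.QuantumManyBody.BoseGas.PeriodicTrialState N L, Literature.MathematicalPhysics.QuantumManyBody.BoseGas.periodicEnergy v Ψ ≤ Literature.MathematicalPhysics.QuantumManyBody.BoseGas.periodicGroundStateEnergy v N L + δ → ∀ K : ℕ, Even K → 0 < K → A / Real.sqrt ((N : ℝ) / L ^ 3) ≤ L / (K : ℝ) ∧ L / (K : ℝ) ≤ 2 * A / Real.sqrt ((N : ℝ) / L ^ 3) → ENNReal.ofReal ((1 - η) * N) ≤ ∑ B : Fin 3 → Fin K, Literature.MathematicalPhysics.QuantumManyBody.BoseGas.cellOccupation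 N L (fun x : EuclideanSpace ℝ (Fin 3) => if (∀ j : Fin 3, ⌊(K : ℝ) * x j / L⌋ = (((B j : Fin K) : ℕ) : ℤ)) then ((((Real.sqrt ((L / (K : ℝ)) ^ 3))⁻¹ : ℝ) : ℂ)) else 0) Ψ.ψ

-- `BlockCondensation` holds: proved by `Summit.AtomisticToContinuum.BoseEinsteinCondensation.Theorems.BlockCondensation.blockCondensation_proof` (its module imports this route file, so no `_holds` link can be stated here).

/-- item stmt-AtomisticToContinuum-0827 · crux · rank 4 · open · by planner
why it might fail: periodic → Dirichlet costs a boundary layer of energy ~ ρ^(2/3)N^(1/3)·L² ≫ gap; the transfer of λ_max between boundary conditions at fixed density is not a theorem (LSSY treat Dirichlet only via the GP route of Ch. 7).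
sources: LSSY2005, stmt-AtomisticToContinuum-0827, stmt-AtomisticToContinuum-0826
[crux] BoundaryTransferWeak (mode-free boundary-condition transfer, per potential): for each
repulsive finite-range v, PeriodicBEC(v) implies ∃ρ₀>0 ∀ρ∈(0,ρ₀) HasGroundStateBEC v ρ (Dirichlet
ground state, λ_max(γ) ≥ cN via condensateNumber). Not glue: near-minimiser slacks are O(N/L²) while
Dirichlet/periodic energies differ by a boundary term ≫ N/L², so no energy-comparison proof;
expected route: Neumann bracketing of interior sub-boxes (−Δ_Dir ≥ ⊕−Δ_Neu, v ≥ 0) + a mode-free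
criterion (λ_max ≥ tr γ²/N). Only the ENERGY analogue is in print (LiebSeiringerSolovejYngvason2005
Ch. 2 after (2.8)). v ≡ 0: hypothesis and conclusion both true. -/
@[route_item "route-AtomisticToContinuum-BlockLatticeFSum", crux]
def BoundaryTransferWeak : Prop :=
  ∀ v : ℝ → ENNReal, Literature.MathematicalPhysics.QuantumManyBody.BoseGas.IsRepulsiveFiniteRange v → (∃ ρ₀ : ℝ, 0 < ρ₀ ∧ ∀ ρ : ℝ, 0 < ρ → ρ < ρ₀ → ∃ c : ℝ, 0 < c ∧ ∀ᶠ N : ℕ in Filter.atTop, ∃ δ : ENNReal, 0 < δ ∧ ∀ Ψ : Literature.MathematicalPhysics.QuantumManyBody.BoseGas.PeriodicTrialState N (Literature.MathematicalPhysics.QuantumManyBody.BoseGas.sideLength ρ N), Literature.MathematicalPhysics.QuantumManyBody.BoseGas.periodicEnergy v Ψ ≤ Literature.MathematicalPhysics.QuantumManyBody.BoseGas.periodicGroundStateEnergy v N (Literature.MathematicalPhysics.QuantumManyBody.BoseGas.sideLength ρ N) + δ → ENNReal.ofReal (c * N) ≤ Literature.MathematicalPhysics.QuantumManyBody.BoseGas.condensateOccupation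 N (Literature.MathematicalPhysics.QuantumManyBody.BoseGas.sideLength ρ N) Ψ.ψ) → ∃ ρ₀ : ℝ, 0 < ρ₀ ∧ ∀ ρ : ℝ, 0 < ρ → ρ < ρ₀ → Literature.MathematicalPhysics.QuantumManyBody.BoseGas.HasGroundStateBEC v ρ

/-- item stmt-AtomisticToContinuum-9093 · support · rank 3 · open · by planner
[crux] (card HC, quantitative half; torus twin of stmt-AtomisticToContinuum-3978) for every
admissible v and M₀ there are C, ρ₀ with: for 0 < ρ < ρ₀, all large N, every L in the density window
there is δ > 0 such that every δ-near-minimiser Ψ of the periodic energy has Var_(|Ψ|²)(Σ_j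
e^(ik·x_j)) ≤ C·N·|k|/√(ρa) for all k = (2π/L)m, m ≠ 0, |k| ≤ M₀√(ρa) (S(k) ≤ C|k|/√(ρa) down to the
lowest mode; Bogoliubov: C → 1/(4√π); necessary for X by Feynman–Bijl). [difficulty: XL] -/
@[route_item "route-AtomisticToContinuum-BlockLatticeFSum", crux]
def TorusHyperuniformity : Prop :=
  ∀ v : ℝ → ENNReal, Literature.MathematicalPhysics.QuantumManyBody.BoseGas.IsRepulsiveFiniteRange v → ∀ M₀ : ℝ, 0 < M₀ → ∃ C : ℝ, 0 < C ∧ ∃ ρ₀ : ℝ, 0 < ρ₀ ∧ ∀ ρ : ℝ, 0 < ρ → ρ < ρ₀ → ∀ᶠ N : ℕ in Filter.atTop, ∀ L : ℝ, 0 < L → ρ / 2 ≤ (N : ℝ) / L ^ 3 → (N : ℝ) / L ^ 3 ≤ 2 * ρ → ∃ δ : ENNReal, 0 < δ ∧ ∀ Ψ : Literature.MathematicalPhysics.QuantumManyBody.BoseGas.PeriodicTrialState N L, Literature.MathematicalPhysics.QuantumManyBody.BoseGas.periodicEnergy v Ψ ≤ Literature.MathematicalPhysics.QuantumManyBody.BoseGas.periodicGroundStateEnergy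 v N L + δ → ∀ m : Fin 3 → ℤ, m ≠ 0 → let a : ℝ := (Literature.MathematicalPhysics.QuantumManyBody.BoseGas.scatteringLength v).toReal; let k : ℝ := 2 * Real.pi / L * ‖(WithLp.toLp 2 fun t => (m t : ℝ) : EuclideanSpace ℝ (Fin 3))‖; k ≤ M₀ * Real.sqrt (ρ * a) → (⨅ c : ℂ, ∫⁻ X in Literature.MathematicalPhysics.QuantumManyBody.BoseGas.cellN N L, (‖(∑ j : Fin N, Complex.exp (Complex.I * ↑(2 * Real.pi / L * ∑ t : Fin 3, (m t : ℝ) * X j t))) - c‖₊ : ENNReal) ^ 2 * (‖Ψ.ψ X‖₊ : ENNReal) ^ 2) ≤ ENNReal.ofReal (C * N * k / Real.sqrt (ρ * a))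

/-- item stmt-AtomisticToContinuum-27507 · support · rank 9 · closed · proved by Summit.AtomisticToContinuum.BoseEinsteinCondensation.Theses.BlockLatticeFSum.SB.shellBudget (prover) · by planner
sources: KLS1988JSP, LSSY2005, stmt-AtomisticToContinuum-13597
[support] PROVABLE NOW (kinematics; the identity is kernel-proved in abstract form in HOME
g22/BlockLatticeFSumEngine.lean: fsum_axis, fsum_total). BlockCondensation (13595) → for every (v,
A, η): ρ₀, N₀ and per box δ (those of 13595 at block constant 2A) such that every δ-near-minimiser
and every K with 4 ∣ K in the A-window satisfy Σ_q ε(q)·⟨f_q, γ_Ψ f_q⟩ ≤ 6ηN, q over {0..K−1}³, f_q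
the block plane waves of 13593. Proof: (1) Σ_q ε(q) n(f_q) = Σ_(j,B) n(a_(B,j)) (finite Plancherel
on (ℤ/K)³); (2) per super-block S and axis: Σ_(4 bonds) n(a) ≤ Σ_(B⊂S) n(u_B) − n(u_S) ≤ N_S −
n(u_S) (n(a)+n(d) = n(u_B)+n(u_B'), u_S = ½Σ_pairs d so n(u_S) ≤ Σ_pairs n(d) by Cauchy–Schwarz,
n(u_B) ≤ N_B); (3) each bond interior to 4 of the 8 half-shifted tilings T_s, and Σ_(S∈T_s) n(u_S) ≥
(1−η)N is 13595 (2A, K/2 even) applied to the translate Ψ(· + s·l) (periodic energy, near-minimality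
and cellOccupation are translation covariant): total ≤ ¼·8·3·ηN. [difficulty: provable-now] -/
@[route_item "route-AtomisticToContinuum-BlockLatticeFSum", crux]
def ShellBudget : Prop :=
  BlockCondensation → ∀ v : ℝ → ENNReal, Literature.MathematicalPhysics.QuantumManyBody.BoseGas.IsRepulsiveFiniteRange v → ∀ A : ℝ, 0 < A → ∀ η : ℝ, 0 < η → ∃ ρ₀ : ℝ, 0 < ρ₀ ∧ ∃ N₀ : ℕ, ∀ (N : ℕ) (L : ℝ), 0 < L → N₀ ≤ N → (N : ℝ) ≤ ρ₀ * L ^ 3 → ∃ δ : ENNReal, 0 < δ ∧ ∀ Ψ : Literature.MathematicalPhysics.QuantumManyBody.BoseGas.PeriodicTrialState N L, Literature.MathematicalPhysics.QuantumManyBody.BoseGas.periodicEnergy v Ψ ≤ Literature.MathematicalPhysics.QuantumManyBody.BoseGas.periodicGroundStateEnergy v N L + δ → ∀ K : ℕ, 4 ∣ K → 0 < K → A / Real.sqrt ((N : ℝ) / L ^ 3) ≤ L / (K : ℝ) ∧ L / (K : ℝ) ≤ 2 * A / Real.sqrt ((N : ℝ) / L ^ 3) → (∑ q : Fin 3 →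 Fin K, ENNReal.ofReal (∑ j : Fin 3, (1 - Real.cos (2 * Real.pi * ((q j : ℕ) : ℝ) / (K : ℝ)))) * Literature.MathematicalPhysics.QuantumManyBody.BoseGas.cellOccupation N L (fun x : EuclideanSpace ℝ (Fin 3) => (((Real.sqrt (L ^ 3))⁻¹ : ℝ) : ℂ) * Complex.exp (((2 * Real.pi * (∑ j : Fin 3, ((q j : ℕ) : ℝ) * (⌊(K : ℝ) * x j / L⌋ : ℝ)) / (K : ℝ) : ℝ) : ℂ) * Complex.I)) Ψ.ψ) ≤ ENNReal.ofReal (6 * η * N)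

-- `ShellBudget` holds: proved by `Summit.AtomisticToContinuum.BoseEinsteinCondensation.Theses.BlockLatticeFSum.SB.shellBudget` (its module imports this route file, so no `_holds` link can be stated here).

/-- item stmt-AtomisticToContinuum-27508 · support · rank 9 · closed · proved by Summit.AtomisticToContinuum.BoseEinsteinCondensation.Theses.BlockLatticeFSum.SMC.shellModeCounting (prover) · by planner
sources: KLS1988JSP, LSSY2005, stmt-AtomisticToContinuum-13597
[support] PROVABLE NOW (Parseval on the block span, as the parent's 13597 (i)): ShellBudgetC →
DeepInfraredEmptiness → BlockCondensation → periodic BEC for every admissible v (the antecedent of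
0827 with c = 5/8). Proof: fix v; the residual gives A, θ, ρ₀; run BlockCondensation with (A, 1/8)
and the budget with (A, θ/48); for ρ below all thresholds and N large (L = (N/ρ)^(1/3), N = ρL³, a K
with 4 ∣ K in the window exists, δ = min): Σ_q n(f_q) = Σ_B n(u_B) ≥ 7N/8, Σ_(q≠0, ε≥θ) n(f_q) ≤
θ⁻¹·6(θ/48)N = N/8 (shell_chebyshev), Σ_(q≠0, ε<θ) ≤ N/8, hence n(f_0) ≥ 5N/8 and f_0·1_cell =
constantMode L. [difficulty: provable-now] -/
@[route_item "route-AtomisticToContinuum-BlockLatticeFSum", crux]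
def ShellModeCounting : Prop :=
  (∀ v : ℝ → ENNReal, Literature.MathematicalPhysics.QuantumManyBody.BoseGas.IsRepulsiveFiniteRange v → ∀ A : ℝ, 0 < A → ∀ η : ℝ, 0 < η → ∃ ρ₀ : ℝ, 0 < ρ₀ ∧ ∃ N₀ : ℕ, ∀ (N : ℕ) (L : ℝ), 0 < L → N₀ ≤ N → (N : ℝ) ≤ ρ₀ * L ^ 3 → ∃ δ : ENNReal, 0 < δ ∧ ∀ Ψ : Literature.MathematicalPhysics.QuantumManyBody.BoseGas.PeriodicTrialState N L, Literature.MathematicalPhysics.QuantumManyBody.BoseGas.periodicEnergy v Ψ ≤ Literature.MathematicalPhysics.QuantumManyBody.BoseGas.periodicGroundStateEnergy v N L + δ → ∀ K : ℕ, 4 ∣ K → 0 < K → A / Real.sqrt ((N : ℝ) / L ^ 3) ≤ L / (K : ℝ) ∧ L / (K : ℝ) ≤ 2 * A / Real.sqrt ((N : ℝ) / L ^ 3) → (∑ q : Fin 3 → Fin K, ENNReal.ofReal (∑ j : Fin 3, (1 - Real.cos (2 * Real.pi * ((q j : ℕ) : ℝ) / (K : ℝ)))) * Literature.MathematicalPhysics.QuantumManyBody.BoseGas.cellOccupation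 N L (fun x : EuclideanSpace ℝ (Fin 3) => (((Real.sqrt (L ^ 3))⁻¹ : ℝ) : ℂ) * Complex.exp (((2 * Real.pi * (∑ j : Fin 3, ((q j : ℕ) : ℝ) * (⌊(K : ℝ) * x j / L⌋ : ℝ)) / (K : ℝ) : ℝ) : ℂ) * Complex.I)) Ψ.ψ) ≤ ENNReal.ofReal (6 * η * N)) → DeepInfraredEmptiness → BlockCondensation → ∀ v : ℝ → ENNReal, Literature.MathematicalPhysics.QuantumManyBody.BoseGas.IsRepulsiveFiniteRange v → ∃ ρ₀ : ℝ, 0 < ρ₀ ∧ ∀ ρ : ℝ, 0 < ρ → ρ < ρ₀ → ∃ c : ℝ, 0 < c ∧ ∀ᶠ N : ℕ in Filter.atTop, ∃ δ : ENNReal, 0 < δ ∧ ∀ Ψ : Literature.MathematicalPhysics.QuantumManyBody.BoseGas.PeriodicTrialState N (Literature.MathematicalPhysics.QuantumManyBody.BoseGas.sideLength ρ N), Literature.MathematicalPhysics.QuantumManyBody.BoseGas.periodicEnergy v Ψ ≤ Literature.MathematicalPhysics.QuantumManyBody.BoseGas.periodicGroundStateEnergy v N (Literature.MathematicalPhysics.QuantumManyBody.BoseGas.sideLength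 ρ N) + δ → ENNReal.ofReal (c * N) ≤ Literature.MathematicalPhysics.QuantumManyBody.BoseGas.condensateOccupation N (Literature.MathematicalPhysics.QuantumManyBody.BoseGas.sideLength ρ N) Ψ.ψ

-- `ShellModeCounting` holds: proved by `Summit.AtomisticToContinuum.BoseEinsteinCondensation.Theses.BlockLatticeFSum.SMC.shellModeCounting` (its module imports this route file, so no `_holds` link can be stated here).

/-- item stmt-AtomisticToContinuum-27509 · assembly · rank 1 · open · by planner
sources: KLS1988JSP, LSSY2005
[assembly] BlockCondensation → ShellBudget → DeepInfraredEmptiness → ShellModeCounting →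
BoundaryTransferWeak → BoseEinsteinCondensation (modus ponens; the deciding theorem `closes` in
glue.lean is exactly this chain). -/
@[route_item "route-AtomisticToContinuum-BlockLatticeFSum"]
def Assembly : Prop :=
  BlockCondensation → ShellBudget → DeepInfraredEmptiness → ShellModeCounting → BoundaryTransferWeak → _root_.BoseEinsteinCondensation

/-! D-0027 §2.1 — DECIDING THEOREM (planner-authored via `route open/edit --closes-file`; by planner-decomp-a2c-lens-6-g22-0 2026-08-31T02:15:53Z):
its hypotheses are this route's items and its conclusion the sub-problem Statement (glue_lint), and it elaborates with this file. -/

@[closes "route-AtomisticToContinuum-BlockLatticeFSum"] theorem closes (hBC : BlockCondensation) (hSB : ShellBudget) (hDI : DeepInfraredEmptiness)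
    (hMC : ShellModeCounting) (hBT : BoundaryTransferWeak) :
    _root_.BoseEinsteinCondensation :=
  fun v hv => hBT v hv (hMC (hSB hBC) hDI hBC v hv)

end Summit.AtomisticToContinuum.BoseEinsteinCondensation.Theses.BlockLatticeFSum
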